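import Summits.Ventures.HSemireg.WedgeHankelRecurrenceGaussJacobiStructure

/-!
# Venture HSemireg — **THE JACOBI DIFFERENTIAL EQUATION AND STIELTJES' ELECTROSTATIC THEOREM FROM THE RECURRENCE** (`α, β > −1`, monic `P̃^{(α,β)}`, data of N402):
# **`(X² − 1) q_n″ + ((α+β+2) X + (α−β)) q_n′ − n(n+α+β+1) q_n = 0`**; at the zeros `−1 < x_0 < ⋯ < x_t < 1` of `q_{t+1}`, STIELTJES' equilibrium
# **`Σ_{j≠k} 1∕(x_k − x_j) = ((α+β+2) x_k + (α−β)) ∕ (2(1 − x_k²)) = ½ ((α+1)∕(1 − x_k) − (β+1)∕(1 + x_k))`** (unit charges at the zeros, charges `(α+1)∕2` at `+1` and `(β+1)∕2` at `−1`),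
# and the sum rules **`Σ_k 1∕(1 − x_k) = (t+1)(t+α+β+2)∕(2(α+1))`**, **`Σ_k 1∕(1 + x_k) = (t+1)(t+α+β+2)∕(2(β+1))`**

HONEST FRAMING. Part of the Lean index of the computation cell `pub-hsemireg` (seat p10 gen 47, Sunday typer «UNIFORM-IN-n»).  Rational identities, polynomial algebra over `ℝ` and finite sums only;
no variety, no cohomology theory, no sheaf, no Ext group and no semiregularity map is constructed here; nothing here says that HC / HC_CM / HC_AV holds; no Literature fact (unproved `Prop`) is
declared or used.  Custodian versions as in `WedgeHankelSiegelIdeal` (1/3).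
SOURCES (cited).  G. Szegő, *Orthogonal Polynomials*, Thm 4.2.1 ∕ (4.2.1) (the Jacobi differential equation `(1−x²)y″ + [β−α−(α+β+2)x] y′ + n(n+α+β+1) y = 0`), Thm 6.7.1 (Stieltjes: the zeros
of `P_n^{(α,β)}` are the equilibrium positions of `n` unit charges in `(−1,1)` with charges `(α+1)∕2`, `(β+1)∕2` at `1`, `−1`); T. J. Stieltjes, *Sur quelques théorèmes d'algèbre*, C. R.
Acad. Sci. Paris 100 (1885) 439–440; S. Ahmed, M. Bruschi, F. Calogero, M. A. Olshanetsky, A. M. Perelomov, *Properties of the zeros of the classical polynomials and of the Bessel functions*,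
Nuovo Cimento B 49 (1979) 173–199 (sum rules `Σ 1∕(1 ∓ x_k)`).
PROOF TYPED HERE.  The differential equation: differentiate N411's `S_{n+2}`, multiply the target by `X² − 1`, substitute `S_{n+2}`, `S_{n+1}` and the recurrence, and close by `linear_combination`
with four scalar identities (`(2n+σ+4) d_{n+2} = (n+2)(β−α)`, `(2n+σ+3) e_{n+2} = (n+2)(n+σ+2) + d_{n+2}² + d_{n+2}(α−β)`, `d_{n+2} + d_{n+1} + (2n+σ+3) a_{n+1} = β − α`, `e_{n+1} = (2n+σ+3) b_{n+1}`);
cancel `X² − 1 ≠ 0`.  Stieltjes' identity: the equation at a zero and N388 `sum_inv_sub_nodes_eq` (`2 f′(x_k) Σ = f″(x_k)`).  Sum rules: the antisymmetric double sums N398 `sum_sum_erase_antisymm`,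
`sum_sum_erase_mul_inv_sub` give two linear equations for `Σ 1∕(1−x_k)`, `Σ 1∕(1+x_k)`.
DEDUP DISCLOSURE (`rg -n -i 'jacobi.*differential|jacobi.*electro|sum_inv_one' Summits/Ventures/HSemireg/WedgeHankelRecurrenceGauss*`, 2026-09-04): N392 ∕ N398 (`α = β`), N389 (Laguerre); the
general `(α, β)` versions are new; 0 hits for the 6 names below.

WHAT IS IN THE TREE.  N411 `jacobi_structure_pair`, `jacobi_scalar_identities`; N388 `sum_inv_sub_nodes_eq`; N284 `eval_derivative_prod_X_sub_C_at_node`; N398 `sum_sum_erase_antisymm`,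
`sum_sum_erase_mul_inv_sub`; N402 `jacobi_zeros_mem` (the zeros lie in `(−1,1)`).
THIS FILE (namespace `Summit.Ventures.HSemireg.Wedge.HankelOuter` continued; CHAINED on N411; 0 definitions):
* §1177 `jacobi_scalar_identities_ode`, **`jacobi_differential_equation`**, **`jacobi_zeros_electrostatic`** (`Σ_{j≠k} 1∕(x_k−x_j) = ((σ+2)x_k + α − β)∕(2(1−x_k²))`),
  `jacobi_zeros_electrostatic'` (the two-charge form), **`jacobi_zeros_sum_inv_one_sub`** (`Σ 1∕(1−x_k)`), **`jacobi_zeros_sum_inv_one_add`** (`Σ 1∕(1+x_k)`).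
CAVEATS.  `α, β > −1`; the zeros are supplied by hypothesis (`StrictMono x`, `q_{t+1} = ∏ (X − x_k)`, `−1 < x_k < 1` — N247 + N402 provide them).  Nothing Ext-side.  New names only.
-/

open Module Polynomial
open scoped Matrix Polynomial

namespace Summit.Ventures.HSemireg.Wedge.HankelOuter

/-! ## §1177. The Jacobi differential equation; Stieltjes' two-charge equilibrium -/

/-- The four rational identities used to pass from the structure relation to the differential equation (`d_m = m(β−α)∕(2m+σ)`, `e_m = (2m+σ+1) b_m`). [Szegő (4.5.1); this file, §1177] -/
theorem jacobi_scalar_identities_ode {a b : ℕ → ℝ} {α β : ℝ} (hα : -1 < α) (hβ : -1 < β) (ha0 : a 0 = (β - α) / (α + β + 2))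
    (ha : ∀ n : ℕ, a (n + 1) = (β ^ 2 - α ^ 2) / ((2 * n + 2 + (α + β)) * (2 * n + 4 + (α + β))))
    (hb : ∀ n : ℕ, b (n + 2) = 4 * ((n : ℝ) + 2) * ((n : ℝ) + 2 + α) * ((n : ℝ) + 2 + β) * ((n : ℝ) + 2 + (α + β)) /
      ((2 * n + 3 + (α + β)) * (2 * n + 4 + (α + β)) ^ 2 * (2 * n + 5 + (α + β))))
    {d e : ℕ → ℝ} (hd : ∀ m, d m = (m : ℝ) * (β - α) / (2 * (m : ℝ) + (α + β))) (he : ∀ m, e m = (2 * (m : ℝ) + 1 + (α + β)) * b m) :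
    (α + β + 2) * a 0 = β - α ∧ (∀ n : ℕ, (2 * (n : ℝ) + 4 + (α + β)) * d (n + 2) = ((n : ℝ) + 2) * (β - α)) ∧
      (∀ n : ℕ, (2 * (n : ℝ) + 3 + (α + β)) * e (n + 2) = ((n : ℝ) + 2) * ((n : ℝ) + 2 + (α + β)) + d (n + 2) ^ 2 + d (n + 2) * (α - β)) ∧
      ∀ n : ℕ, d (n + 2) + d (n + 1) + (2 * (n : ℝ) + 3 + (α + β)) * a (n + 1) = β - α := by
  have h2 : α + β + 2 ≠ 0 := by linarith
  have hn : ∀ (m : ℕ) (k : ℝ), 2 ≤ k → 2 * (m : ℝ) + k + (α + β) ≠ 0 := fun m k hk => by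
    have h0 : (0 : ℝ) ≤ m := Nat.cast_nonneg m
    linarith
  have hD1 : ∀ m : ℕ, d (m + 1) = ((m : ℝ) + 1) * (β - α) / (2 * (m : ℝ) + 2 + (α + β)) := fun m => by
    rw [hd]; push_cast; rw [div_eq_div_iff (by have := hn m 2 (by norm_num); intro h; apply this; linarith) (hn m 2 (by norm_num))]; ring
  have hD2 : ∀ m : ℕ, d (m + 2) = ((m : ℝ) + 2) * (β - α) / (2 * (m : ℝ) + 4 + (α + β)) := fun m => by
    rw [hd]; push_cast; rw [div_eq_div_iff (by have := hn m 4 (by norm_num); intro h; apply this; linarith) (hn m 4 (by norm_num))]; ring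
  refine ⟨by rw [ha0]; field_simp, fun n => ?_, fun n => ?_, fun n => ?_⟩
  · rw [hD2, mul_div_assoc', mul_comm (2 * (n : ℝ) + 4 + (α + β)), mul_div_assoc, div_self (hn n 4 (by norm_num)), mul_one]
  · have h3 := hn n 3 (by norm_num); have h4 := hn n 4 (by norm_num); have h5 := hn n 5 (by norm_num)
    have hL : (2 * (n : ℝ) + 3 + (α + β)) * e (n + 2) =
        4 * ((n : ℝ) + 2) * ((n : ℝ) + 2 + α) * ((n : ℝ) + 2 + β) * ((n : ℝ) + 2 + (α + β)) / (2 * (n : ℝ) + 4 + (α + β)) ^ 2 := by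
      rw [he, hb n]; push_cast
      rw [mul_div_assoc', mul_div_assoc', div_eq_div_iff (mul_ne_zero (mul_ne_zero h3 (pow_ne_zero 2 h4)) h5) (pow_ne_zero 2 h4)]
      ring
    have hd' : d (n + 2) * (2 * (n : ℝ) + 4 + (α + β)) = ((n : ℝ) + 2) * (β - α) := by rw [hD2, div_mul_cancel₀ _ h4]
    rw [hL, div_eq_iff (pow_ne_zero 2 h4)]
    linear_combination (-(d (n + 2) * (2 * (n : ℝ) + 4 + (α + β)) + ((n : ℝ) + 2) * (β - α) + (α - β) * (2 * (n : ℝ) + 4 + (α + β)))) * hd'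
  · have h6 := hn n 2 (by norm_num); have h7 := hn n 4 (by norm_num)
    rw [hD2, hD1, ha n, mul_div_assoc', div_add_div _ _ h7 h6, div_add_div _ _ (mul_ne_zero h7 h6) (mul_ne_zero h6 h7), div_eq_iff (mul_ne_zero (mul_ne_zero h7 h6) (mul_ne_zero h6 h7))]
    ring

/-- **THE JACOBI DIFFERENTIAL EQUATION FROM THE RECURRENCE: `(X² − 1) q_n″ + ((α+β+2) X + (α−β)) q_n′ − n(n+α+β+1) q_n = 0`** (monic `P̃_n^{(α,β)}`, `α, β > −1`). [Szegő Thm 4.2.1;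
this file, §1177] -/
theorem jacobi_differential_equation {q : ℕ → ℝ[X]} {a b : ℕ → ℝ} {α β : ℝ} (hq0 : q 0 = 1) (hq1 : q 1 = Polynomial.X - C (a 0))
    (hrec : ∀ n, q (n + 2) = (Polynomial.X - C (a (n + 1))) * q (n + 1) - C (b (n + 1)) * q n) (hα : -1 < α) (hβ : -1 < β) (ha0 : a 0 = (β - α) / (α + β + 2))
    (ha : ∀ n : ℕ, a (n + 1) = (β ^ 2 - α ^ 2) / ((2 * n + 2 + (α + β)) * (2 * n + 4 + (α + β))))
    (hb1 : b 1 = 4 * (1 + α) * (1 + β) / ((α + β + 2) ^ 2 * (α + β + 3)))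
    (hb : ∀ n : ℕ, b (n + 2) = 4 * ((n : ℝ) + 2) * ((n : ℝ) + 2 + α) * ((n : ℝ) + 2 + β) * ((n : ℝ) + 2 + (α + β)) /
      ((2 * n + 3 + (α + β)) * (2 * n + 4 + (α + β)) ^ 2 * (2 * n + 5 + (α + β)))) (n : ℕ) :
    (Polynomial.X ^ 2 - 1) * derivative (derivative (q n)) + (C (α + β + 2) * Polynomial.X + C (α - β)) * derivative (q n) - C ((n : ℝ) * ((n : ℝ) + 1 + (α + β))) * q n = 0 := by
  have hS : (Polynomial.X ^ 2 - 1 : ℝ[X]) ≠ 0 := by rw [← C_1]; exact X_pow_sub_C_ne_zero two_pos 1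
  obtain ⟨d, hd⟩ : ∃ d : ℕ → ℝ, d = fun m : ℕ => (m : ℝ) * (β - α) / (2 * (m : ℝ) + (α + β)) := ⟨_, rfl⟩
  obtain ⟨e, he⟩ : ∃ e : ℕ → ℝ, e = fun m : ℕ => (2 * (m : ℝ) + 1 + (α + β)) * b m := ⟨_, rfl⟩
  have hdv : ∀ m, d m = (m : ℝ) * (β - α) / (2 * (m : ℝ) + (α + β)) := fun m => by rw [hd]
  have hev : ∀ m, e m = (2 * (m : ℝ) + 1 + (α + β)) * b m := fun m => by rw [he]
  obtain ⟨hA0, hD2, hQ, hR⟩ := jacobi_scalar_identities_ode hα hβ ha0 ha hb hdv hev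
  rcases n with _ | n
  · rw [hq0]; simp
  rcases n with _ | n
  · rw [zero_add, hq1, derivative_sub, derivative_X, derivative_C, sub_zero, derivative_one, mul_zero, zero_add, mul_one]
    have h := congrArg C hA0
    simp only [map_mul, map_add, map_sub, map_ofNat] at h
    simp only [Nat.cast_one, map_mul, map_add, map_sub, map_one, map_ofNat]
    linear_combination h
  · -- degree `n + 2`
    obtain ⟨e2, e0⟩ := jacobi_structure_pair hq0 hq1 hrec hα hβ ha0 ha hb1 hb hdv hev n
    have e3 : q (n + 2) = (Polynomial.X - C (a (n + 1))) * q (n + 1) - C (b (n + 1)) * q n := hrec n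
    have e1 : 2 * Polynomial.X * derivative (q (n + 2)) + (Polynomial.X ^ 2 - 1) * derivative (derivative (q (n + 2))) =
        ((n : ℝ[X]) + 2) * q (n + 2) + (((n : ℝ[X]) + 2) * Polynomial.X + C (d (n + 2))) * derivative (q (n + 2)) - C (e (n + 2)) * derivative (q (n + 1)) := by
      have h := congrArg derivative e0
      simp only [derivative_mul, derivative_sub, derivative_X_sq, derivative_one, derivative_X, derivative_C, derivative_add, derivative_natCast, derivative_ofNat, map_ofNat,
        zero_mul, zero_add, sub_zero, mul_one, add_zero] at h
      linear_combination h
    -- the scalar identities through `C`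
    have hE1 : C (e (n + 1)) = (2 * (n : ℝ[X]) + 3 + (C α + C β)) * C (b (n + 1)) := by
      rw [hev]; push_cast; simp only [map_add, map_mul, map_one, map_natCast, map_ofNat]; ring
    have hD2C : (2 * (n : ℝ[X]) + 4 + (C α + C β)) * C (d (n + 2)) = ((n : ℝ[X]) + 2) * (C β - C α) := by
      have h := congrArg C (hD2 n); simpa only [map_add, map_mul, map_sub, map_natCast, map_ofNat] using h
    have hQC : (2 * (n : ℝ[X]) + 3 + (C α + C β)) * C (e (n + 2)) = ((n : ℝ[X]) + 2) * ((n : ℝ[X]) + 2 + (C α + C β)) + C (d (n + 2)) ^ 2 + C (d (n + 2)) * (C α - C β) := by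
      have h := congrArg C (hQ n); simpa only [map_add, map_mul, map_sub, map_pow, map_natCast, map_ofNat] using h
    have hRC : C (d (n + 2)) + C (d (n + 1)) + (2 * (n : ℝ[X]) + 3 + (C α + C β)) * C (a (n + 1)) = C β - C α := by
      have h := congrArg C (hR n); simpa only [map_add, map_mul, map_sub, map_natCast, map_ofNat] using h
    simp only [map_add, map_mul, map_sub, map_one, map_ofNat, map_natCast]
    push_cast
    apply mul_left_cancel₀ hS
    rw [mul_zero]
    linear_combination (Polynomial.X ^ 2 - 1) * e1 + (((n : ℝ[X]) + C α + C β + 2) * Polynomial.X + C (d (n + 2)) + C α - C β) * e0 - C (e (n + 2)) * e2 +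
      ((2 * (n : ℝ[X]) + 3 + (C α + C β)) * C (e (n + 2))) * e3 + (C (e (n + 2)) * q n) * hE1 + (Polynomial.X * q (n + 2)) * hD2C - (q (n + 2)) * hQC -
      (C (e (n + 2)) * q (n + 1)) * hRC

/-- **STIELTJES' EQUILIBRIUM FOR THE JACOBI ZEROS: `Σ_{j≠k} 1∕(x_k − x_j) = ((α+β+2) x_k + (α−β)) ∕ (2(1 − x_k²))`** at the zeros `−1 < x_0 < ⋯ < x_t < 1` of `P̃_{t+1}^{(α,β)}`. [Stieltjes 1885;
Szegő Thm 6.7.1; this file, §1177] -/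
theorem jacobi_zeros_electrostatic {q : ℕ → ℝ[X]} {a b : ℕ → ℝ} {α β : ℝ} (hq0 : q 0 = 1) (hq1 : q 1 = Polynomial.X - C (a 0))
    (hrec : ∀ n, q (n + 2) = (Polynomial.X - C (a (n + 1))) * q (n + 1) - C (b (n + 1)) * q n) (hα : -1 < α) (hβ : -1 < β) (ha0 : a 0 = (β - α) / (α + β + 2))
    (ha : ∀ n : ℕ, a (n + 1) = (β ^ 2 - α ^ 2) / ((2 * n + 2 + (α + β)) * (2 * n + 4 + (α + β))))
    (hb1 : b 1 = 4 * (1 + α) * (1 + β) / ((α + β + 2) ^ 2 * (α + β + 3)))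
    (hb : ∀ n : ℕ, b (n + 2) = 4 * ((n : ℝ) + 2) * ((n : ℝ) + 2 + α) * ((n : ℝ) + 2 + β) * ((n : ℝ) + 2 + (α + β)) /
      ((2 * n + 3 + (α + β)) * (2 * n + 4 + (α + β)) ^ 2 * (2 * n + 5 + (α + β))))
    {t : ℕ} {x : Fin (t + 1) → ℝ} (hx : StrictMono x) (hxq : q (t + 1) = ∏ k, (Polynomial.X - C (x k))) (hmem : ∀ k, -1 < x k ∧ x k < 1) (k : Fin (t + 1)) :
    ∑ j ∈ Finset.univ.erase k, (x k - x j)⁻¹ = ((α + β + 2) * x k + (α - β)) / (2 * (1 - x k ^ 2)) := by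
  have hinj := hx.injective
  have hode := congrArg (eval (x k)) (jacobi_differential_equation hq0 hq1 hrec hα hβ ha0 ha hb1 hb (t + 1))
  rw [hxq] at hode
  have hroot : (∏ j, (Polynomial.X - C (x j))).eval (x k) = 0 := by rw [eval_prod]; exact Finset.prod_eq_zero (Finset.mem_univ k) (by simp)
  rw [eval_sub, eval_add, eval_mul, eval_mul, eval_mul, eval_add, eval_mul, eval_sub, eval_pow, eval_X, eval_one, eval_C, eval_C, eval_C, hroot, mul_zero, sub_zero, eval_zero,
    ← sum_inv_sub_nodes_eq hinj k] at hode
  have hder : (derivative (∏ i, (Polynomial.X - C (x i)))).eval (x k) ≠ 0 := by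
    rw [eval_derivative_prod_X_sub_C_at_node]
    exact Finset.prod_ne_zero_iff.2 fun j hj => sub_ne_zero.2 fun h => (Finset.mem_erase.1 hj).1 (hinj h).symm
  have h1 : 0 < 1 - x k ^ 2 := by nlinarith [(hmem k).1, (hmem k).2]
  rw [eq_div_iff (by positivity)]
  apply mul_left_cancel₀ hder
  linear_combination (-1 : ℝ) * hode

/-- **THE TWO-CHARGE FORM: `Σ_{j≠k} 1∕(x_k − x_j) = ½ ((α+1)∕(1 − x_k) − (β+1)∕(1 + x_k))`** (charges `(α+1)∕2` at `+1`, `(β+1)∕2` at `−1`). [Szegő Thm 6.7.1; this file, §1177] -/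
theorem jacobi_zeros_electrostatic' {q : ℕ → ℝ[X]} {a b : ℕ → ℝ} {α β : ℝ} (hq0 : q 0 = 1) (hq1 : q 1 = Polynomial.X - C (a 0))
    (hrec : ∀ n, q (n + 2) = (Polynomial.X - C (a (n + 1))) * q (n + 1) - C (b (n + 1)) * q n) (hα : -1 < α) (hβ : -1 < β) (ha0 : a 0 = (β - α) / (α + β + 2))
    (ha : ∀ n : ℕ, a (n + 1) = (β ^ 2 - α ^ 2) / ((2 * n + 2 + (α + β)) * (2 * n + 4 + (α + β))))
    (hb1 : b 1 = 4 * (1 + α) * (1 + β) / ((α + β + 2) ^ 2 * (α + β + 3)))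
    (hb : ∀ n : ℕ, b (n + 2) = 4 * ((n : ℝ) + 2) * ((n : ℝ) + 2 + α) * ((n : ℝ) + 2 + β) * ((n : ℝ) + 2 + (α + β)) /
      ((2 * n + 3 + (α + β)) * (2 * n + 4 + (α + β)) ^ 2 * (2 * n + 5 + (α + β))))
    {t : ℕ} {x : Fin (t + 1) → ℝ} (hx : StrictMono x) (hxq : q (t + 1) = ∏ k, (Polynomial.X - C (x k))) (hmem : ∀ k, -1 < x k ∧ x k < 1) (k : Fin (t + 1)) :
    ∑ j ∈ Finset.univ.erase k, (x k - x j)⁻¹ = ((α + 1) / (1 - x k) - (β + 1) / (1 + x k)) / 2 := by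
  rw [jacobi_zeros_electrostatic hq0 hq1 hrec hα hβ ha0 ha hb1 hb hx hxq hmem k]
  have h1 : 1 - x k ≠ 0 := by linarith [(hmem k).2]
  have h2 : 1 + x k ≠ 0 := by linarith [(hmem k).1]
  have h3 : 1 - x k ^ 2 ≠ 0 := by nlinarith [(hmem k).1, (hmem k).2]
  field_simp
  ring

/-- **SUM RULE: `Σ_k 1∕(1 − x_k) = (t+1)(t+α+β+2) ∕ (2(α+1))`** for the zeros of `P̃_{t+1}^{(α,β)}` (`= q_{t+1}′(1)∕q_{t+1}(1)`). [Ahmed–Bruschi–Calogero–Olshanetsky–Perelomov 1979; Szegő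
§6.7; this file, §1177] -/
theorem jacobi_zeros_sum_inv_one_sub {q : ℕ → ℝ[X]} {a b : ℕ → ℝ} {α β : ℝ} (hq0 : q 0 = 1) (hq1 : q 1 = Polynomial.X - C (a 0))
    (hrec : ∀ n, q (n + 2) = (Polynomial.X - C (a (n + 1))) * q (n + 1) - C (b (n + 1)) * q n) (hα : -1 < α) (hβ : -1 < β) (ha0 : a 0 = (β - α) / (α + β + 2))
    (ha : ∀ n : ℕ, a (n + 1) = (β ^ 2 - α ^ 2) / ((2 * n + 2 + (α + β)) * (2 * n + 4 + (α + β))))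
    (hb1 : b 1 = 4 * (1 + α) * (1 + β) / ((α + β + 2) ^ 2 * (α + β + 3)))
    (hb : ∀ n : ℕ, b (n + 2) = 4 * ((n : ℝ) + 2) * ((n : ℝ) + 2 + α) * ((n : ℝ) + 2 + β) * ((n : ℝ) + 2 + (α + β)) /
      ((2 * n + 3 + (α + β)) * (2 * n + 4 + (α + β)) ^ 2 * (2 * n + 5 + (α + β))))
    {t : ℕ} {x : Fin (t + 1) → ℝ} (hx : StrictMono x) (hxq : q (t + 1) = ∏ k, (Polynomial.X - C (x k))) (hmem : ∀ k, -1 < x k ∧ x k < 1) :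
    ∑ k, (1 - x k)⁻¹ = ((t : ℝ) + 1) * ((t : ℝ) + 2 + (α + β)) / (2 * (α + 1)) := by
  have hel := fun k => jacobi_zeros_electrostatic' hq0 hq1 hrec hα hβ ha0 ha hb1 hb hx hxq hmem k
  have hanti := sum_sum_erase_antisymm (fun k j : Fin (t + 1) => (x k - x j)⁻¹) fun k j => by rw [← inv_neg, neg_sub]
  have hpair := sum_sum_erase_mul_inv_sub hx.injective
  simp_rw [← Finset.mul_sum] at hpair
  rw [Finset.sum_congr rfl fun k _ => hel k] at hanti
  rw [Finset.sum_congr rfl fun k _ => by rw [hel k]] at hpair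
  -- rewrite the two kernels in terms of `1/(1−x)` and `1/(1+x)`
  have hterm1 : ∀ k, ((α + 1) / (1 - x k) - (β + 1) / (1 + x k)) / 2 = (α + 1) / 2 * (1 - x k)⁻¹ - (β + 1) / 2 * (1 + x k)⁻¹ := fun k => by ring
  have hterm2 : ∀ k, x k * (((α + 1) / (1 - x k) - (β + 1) / (1 + x k)) / 2) = (α + 1) / 2 * (1 - x k)⁻¹ + (β + 1) / 2 * (1 + x k)⁻¹ - (α + β + 2) / 2 := fun k => by
    have h1 : 1 - x k ≠ 0 := by linarith [(hmem k).2]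
    have h2 : 1 + x k ≠ 0 := by linarith [(hmem k).1]
    field_simp; ring
  simp_rw [hterm1, Finset.sum_sub_distrib, ← Finset.mul_sum] at hanti
  simp_rw [hterm2, Finset.sum_sub_distrib, Finset.sum_add_distrib, ← Finset.mul_sum, Finset.sum_const, Finset.card_univ, Fintype.card_fin, nsmul_eq_mul] at hpair
  push_cast at hpair
  have hα1 : α + 1 ≠ 0 := by linarith
  rw [eq_div_iff (mul_ne_zero two_ne_zero hα1)]
  linarith

/-- **SUM RULE: `Σ_k 1∕(1 + x_k) = (t+1)(t+α+β+2) ∕ (2(β+1))`.** [Ahmed et al. 1979; this file, §1177] -/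
theorem jacobi_zeros_sum_inv_one_add {q : ℕ → ℝ[X]} {a b : ℕ → ℝ} {α β : ℝ} (hq0 : q 0 = 1) (hq1 : q 1 = Polynomial.X - C (a 0))
    (hrec : ∀ n, q (n + 2) = (Polynomial.X - C (a (n + 1))) * q (n + 1) - C (b (n + 1)) * q n) (hα : -1 < α) (hβ : -1 < β) (ha0 : a 0 = (β - α) / (α + β + 2))
    (ha : ∀ n : ℕ, a (n + 1) = (β ^ 2 - α ^ 2) / ((2 * n + 2 + (α + β)) * (2 * n + 4 + (α + β))))
    (hb1 : b 1 = 4 * (1 + α) * (1 + β) / ((α + β + 2) ^ 2 * (α + β + 3)))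
    (hb : ∀ n : ℕ, b (n + 2) = 4 * ((n : ℝ) + 2) * ((n : ℝ) + 2 + α) * ((n : ℝ) + 2 + β) * ((n : ℝ) + 2 + (α + β)) /
      ((2 * n + 3 + (α + β)) * (2 * n + 4 + (α + β)) ^ 2 * (2 * n + 5 + (α + β))))
    {t : ℕ} {x : Fin (t + 1) → ℝ} (hx : StrictMono x) (hxq : q (t + 1) = ∏ k, (Polynomial.X - C (x k))) (hmem : ∀ k, -1 < x k ∧ x k < 1) :
    ∑ k, (1 + x k)⁻¹ = ((t : ℝ) + 1) * ((t : ℝ) + 2 + (α + β)) / (2 * (β + 1)) := by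
  have hel := fun k => jacobi_zeros_electrostatic' hq0 hq1 hrec hα hβ ha0 ha hb1 hb hx hxq hmem k
  have hanti := sum_sum_erase_antisymm (fun k j : Fin (t + 1) => (x k - x j)⁻¹) fun k j => by rw [← inv_neg, neg_sub]
  rw [Finset.sum_congr rfl fun k _ => hel k] at hanti
  have hterm1 : ∀ k, ((α + 1) / (1 - x k) - (β + 1) / (1 + x k)) / 2 = (α + 1) / 2 * (1 - x k)⁻¹ - (β + 1) / 2 * (1 + x k)⁻¹ := fun k => by ring
  simp_rw [hterm1, Finset.sum_sub_distrib, ← Finset.mul_sum] at hanti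
  rw [jacobi_zeros_sum_inv_one_sub hq0 hq1 hrec hα hβ ha0 ha hb1 hb hx hxq hmem] at hanti
  have hα1 : α + 1 ≠ 0 := by linarith
  have hβ1 : β + 1 ≠ 0 := by linarith
  have key : (α + 1) / 2 * (((t : ℝ) + 1) * ((t : ℝ) + 2 + (α + β)) / (2 * (α + 1))) = ((t : ℝ) + 1) * ((t : ℝ) + 2 + (α + β)) / 4 := by
    field_simp
    ring
  rw [key] at hanti
  rw [eq_div_iff (mul_ne_zero two_ne_zero hβ1)]
  linarith

end Summit.Ventures.HSemireg.Wedge.HankelOuter
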